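import Literature.Probability.LatticeModels.BalabanStepOneFormatBasic

/-!
# Balaban's step-one format — polymer combinatorics: the canonical admissible family

Generic combinatorics of the large-field polymer gas of
`Literature.Probability.LatticeModels.BalabanStepOne.StepOneFormat` on the block torus
`Site L' M = (ℤ/L')² × ℤ/M`, needed by every MEMBERSHIP proof (calibration of the format by the XY
Gibbs weight; later the Hubbard pair-phase weight):

* `Near` / `Close` — graph distance `≤ 1` / `≤ 3` in the nearest-neighbour graph `adjGraph`;
  `mem_collar` — the collar of `P` is the set of sites near a site of `P`;
* `comp Ω x` — the class of `x` in the large-field set `Ω` under chains of `Ω`-sites with consecutive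
  distance `≤ 3`; `canon Ω` — the CANONICAL POLYMER FAMILY `{collar (comp Ω x) : x ∈ Ω}`;
* `adm_canon` — the canonical family is admissible (`Adm`): each polymer meets `Ω`, distinct polymers
  are disjoint and non-adjacent (classes are at mutual distance `≥ 4`, so their collars are at distance
  `≥ 2`), the family covers `Ω`;
* `isConn_collar_comp` — each canonical polymer is connected;
* `adm_eq_canon` — UNIQUENESS: an admissible family all of whose polymers are connected and
  collar-closed (`P = collar (P ∩ Ω)`) IS the canonical family (so the polymer gas of a weight whose
  activities vanish off such polymers collapses to one product: `BalabanStepOneFormatPolymerGas`).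

Folklore (Kotecký–Preiss polymer bookkeeping; Balaban CMP 167 (1995) §1 for the format); no fact about
any engine is asserted.
-/

noncomputable section

open scoped BigOperators Classical
open Finset

namespace Literature.Probability.LatticeModels.BalabanStepOne

variable {L' M : ℕ}

/-! ### Distance `≤ 1` and `≤ 3` on the block torus -/

/-- Adjacency in the nearest-neighbour graph of the block torus, unfolded. [folklore] -/
theorem adjGraph_adj {s s' : Site L' M} :
    (adjGraph L' M).Adj s s' ↔ s ≠ s' ∧ ((∃ i, s' = s + dir L' M i) ∨ ∃ i, s = s' + dir L' M i) := by
  simp [adjGraph, SimpleGraph.fromRel_adj]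

/-- `Near x y`: `y` equals `x` or is adjacent to it (graph distance `≤ 1`). [folklore] -/
def Near (x y : Site L' M) : Prop := x = y ∨ (adjGraph L' M).Adj x y

/-- `Near` is reflexive. [folklore] -/
theorem near_refl (x : Site L' M) : Near x x := Or.inl rfl

/-- `Near` is symmetric. [folklore] -/
theorem Near.symm {x y : Site L' M} (h : Near x y) : Near y x :=
  h.elim (fun e => Or.inl e.symm) fun a => Or.inr a.symm

/-- A site is near its forward neighbours. [folklore] -/
theorem near_add_dir (s : Site L' M) (i : Fin 3) : Near s (s + dir L' M i) := by
  by_cases h : s = s + dir L' M i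
  · exact Or.inl h
  · exact Or.inr (adjGraph_adj.2 ⟨h, Or.inl ⟨i, rfl⟩⟩)

/-- A site is near its backward neighbours. [folklore] -/
theorem near_sub_dir (s : Site L' M) (i : Fin 3) : Near s (s - dir L' M i) := by
  have h := near_add_dir (s - dir L' M i) i
  rw [sub_add_cancel] at h
  exact h.symm

/-- `Near` is translation invariant. [folklore] -/
theorem near_add_right_iff (x y t : Site L' M) : Near (x + t) (y + t) ↔ Near x y := by
  unfold Near
  rw [adjGraph_adj, adjGraph_adj]
  simp only [add_right_cancel_iff, ne_eq, add_right_comm _ t]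

/-- `Close x y`: a chain `x ~ a ~ b ~ y` of three `Near` steps (graph distance `≤ 3`). [folklore] -/
def Close (x y : Site L' M) : Prop := ∃ a b, Near x a ∧ Near a b ∧ Near b y

/-- `Close` is symmetric. [folklore] -/
theorem Close.symm {x y : Site L' M} (h : Close x y) : Close y x := by
  obtain ⟨a, b, h1, h2, h3⟩ := h
  exact ⟨b, a, h3.symm, h2.symm, h1.symm⟩

/-- Near sites are close. [folklore] -/
theorem Near.close {x y : Site L' M} (h : Near x y) : Close x y :=
  ⟨y, y, h, near_refl y, near_refl y⟩

section collar

variable [NeZero L'] [NeZero M]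

/-- Membership in the collar: `y ∈ collar P` iff `y` is near some site of `P`. [folklore] -/
theorem mem_collar {P : Finset (Site L' M)} {y : Site L' M} :
    y ∈ collar P ↔ ∃ x ∈ P, Near x y := by
  unfold collar Near
  simp only [mem_union, mem_biUnion, mem_filter, mem_univ, true_and]
  constructor
  · rintro (h | ⟨x, hx, h⟩)
    · exact ⟨y, h, Or.inl rfl⟩
    · exact ⟨x, hx, Or.inr h⟩
  · rintro ⟨x, hx, h | h⟩
    · subst h; exact Or.inl hx
    · exact Or.inr ⟨x, hx, h⟩

/-- A near site of a member lies in the collar. [folklore] -/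
theorem mem_collar_of_near {P : Finset (Site L' M)} {x y : Site L' M} (hx : x ∈ P) (h : Near x y) :
    y ∈ collar P :=
  mem_collar.2 ⟨x, hx, h⟩

/-- `P ⊆ collar P`. [folklore] -/
theorem subset_collar (P : Finset (Site L' M)) : P ⊆ collar P :=
  fun x hx => mem_collar_of_near hx (near_refl x)

/-- The collar is monotone. [folklore] -/
theorem collar_mono {P Q : Finset (Site L' M)} (h : P ⊆ Q) : collar P ⊆ collar Q := by
  intro y hy
  obtain ⟨x, hx, hxy⟩ := mem_collar.1 hy
  exact mem_collar_of_near (h hx) hxy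

/-- The collar of a set has at most `7` sites per site of the set. [folklore] -/
theorem card_collar_le (P : Finset (Site L' M)) : (collar P).card ≤ 7 * P.card := by
  classical
  have hsub : collar P ⊆ P.biUnion fun x =>
      insert x ((univ : Finset (Fin 3)).image (fun i => x + dir L' M i) ∪
        (univ : Finset (Fin 3)).image fun i => x - dir L' M i) := by
    intro y hy
    obtain ⟨x, hx, hxy⟩ := mem_collar.1 hy
    refine mem_biUnion.2 ⟨x, hx, ?_⟩
    rcases hxy with rfl | h
    · exact mem_insert_self _ _
    · rcases adjGraph_adj.1 h with ⟨-, ⟨i, rfl⟩ | ⟨i, hi⟩⟩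
      · exact mem_insert_of_mem (mem_union_left _ (mem_image.2 ⟨i, mem_univ _, rfl⟩))
      · refine mem_insert_of_mem (mem_union_right _ (mem_image.2 ⟨i, mem_univ _, ?_⟩))
        rw [hi, add_sub_cancel_right]
  refine (card_le_card hsub).trans ((card_biUnion_le).trans ?_)
  have hle : ∀ x ∈ P, (insert x ((univ : Finset (Fin 3)).image (fun i => x + dir L' M i) ∪
      (univ : Finset (Fin 3)).image fun i => x - dir L' M i)).card ≤ 7 := by
    intro x _
    refine (card_insert_le _ _).trans ?_
    have h1 : ((univ : Finset (Fin 3)).image fun i => x + dir L' M i).card ≤ 3 :=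
      card_image_le.trans (by simp)
    have h2 : ((univ : Finset (Fin 3)).image fun i => x - dir L' M i).card ≤ 3 :=
      card_image_le.trans (by simp)
    have := card_union_le ((univ : Finset (Fin 3)).image fun i => x + dir L' M i)
      ((univ : Finset (Fin 3)).image fun i => x - dir L' M i)
    omega
  calc _ ≤ ∑ _a ∈ P, 7 := sum_le_sum hle
    _ = 7 * P.card := by rw [sum_const, smul_eq_mul, mul_comm]

/-- The collar adds at most `6` sites per site. [folklore] -/
theorem card_collar_sdiff_le (P : Finset (Site L' M)) : (collar P \ P).card ≤ 6 * P.card := by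
  have h := card_collar_le P
  rw [card_sdiff_of_subset (subset_collar P)]
  omega

/-- The collar is translation covariant. [folklore] -/
theorem collar_image_add (P : Finset (Site L' M)) (t : Site L' M) :
    collar (P.image (· + t)) = (collar P).image (· + t) := by
  ext y
  simp only [mem_collar, mem_image]
  constructor
  · rintro ⟨x, ⟨x₀, hx₀, rfl⟩, h⟩
    refine ⟨y - t, ⟨x₀, hx₀, ?_⟩, sub_add_cancel y t⟩
    rw [← near_add_right_iff _ _ t, sub_add_cancel]
    exact h
  · rintro ⟨y₀, ⟨x, hx, h⟩, rfl⟩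
    exact ⟨x + t, ⟨x, hx, rfl⟩, (near_add_right_iff _ _ t).2 h⟩

end collar

/-! ### Classes of the large-field set under distance-`≤ 3` chains -/

/-- One link of a chain inside `Ω`: both ends in `Ω`, at distance `≤ 3`. [folklore] -/
def lnk (Ω : Finset (Site L' M)) (a b : Site L' M) : Prop := a ∈ Ω ∧ b ∈ Ω ∧ Close a b

/-- Chains are reversible (the link relation is symmetric). [folklore] -/
theorem reflTransGen_lnk_symm {Ω : Finset (Site L' M)} {x y : Site L' M}
    (h : Relation.ReflTransGen (lnk Ω) x y) : Relation.ReflTransGen (lnk Ω) y x := by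
  induction h with
  | refl => exact Relation.ReflTransGen.refl
  | tail _ hbc ih => exact Relation.ReflTransGen.head ⟨hbc.2.1, hbc.1, hbc.2.2.symm⟩ ih

/-- The class of `x` in `Ω`: sites of `Ω` reachable from `x` by a chain of `Ω`-sites with consecutive
graph distance `≤ 3`. [folklore] -/
def comp (Ω : Finset (Site L' M)) (x : Site L' M) : Finset (Site L' M) :=
  Ω.filter fun y => Relation.ReflTransGen (lnk Ω) x y

/-- Membership in a class, unfolded. [folklore] -/
theorem mem_comp {Ω : Finset (Site L' M)} {x y : Site L' M} :
    y ∈ comp Ω x ↔ y ∈ Ω ∧ Relation.ReflTransGen (lnk Ω) x y := mem_filter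

/-- Classes are subsets of `Ω`. [folklore] -/
theorem comp_subset (Ω : Finset (Site L' M)) (x : Site L' M) : comp Ω x ⊆ Ω := filter_subset _ _

/-- A site of `Ω` lies in its own class. [folklore] -/
theorem mem_comp_self {Ω : Finset (Site L' M)} {x : Site L' M} (hx : x ∈ Ω) : x ∈ comp Ω x :=
  mem_comp.2 ⟨hx, Relation.ReflTransGen.refl⟩

/-- Classes are closed under one more link. [folklore] -/
theorem mem_comp_of_close {Ω : Finset (Site L' M)} {x y z : Site L' M} (hy : y ∈ comp Ω x)
    (hz : z ∈ Ω) (h : Close y z) : z ∈ comp Ω x :=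
  mem_comp.2 ⟨hz, (mem_comp.1 hy).2.tail ⟨(mem_comp.1 hy).1, hz, h⟩⟩

/-- Two sites in one class have the same class. [folklore] -/
theorem comp_eq_of_mem {Ω : Finset (Site L' M)} {x y : Site L' M} (hy : y ∈ comp Ω x) :
    comp Ω y = comp Ω x := by
  have hxy := (mem_comp.1 hy).2
  ext z
  simp only [mem_comp]
  constructor
  · rintro ⟨hz, h⟩
    exact ⟨hz, hxy.trans h⟩
  · rintro ⟨hz, h⟩
    exact ⟨hz, (reflTransGen_lnk_symm hxy).trans h⟩

/-- Distinct classes contain no pair of close sites. [folklore] -/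
theorem not_close_of_comp_ne {Ω : Finset (Site L' M)} {x x' y y' : Site L' M}
    (hne : comp Ω x ≠ comp Ω x') (hy : y ∈ comp Ω x) (hy' : y' ∈ comp Ω x') : ¬ Close y y' := by
  intro hc
  have h1 : y' ∈ comp Ω x := mem_comp_of_close hy (comp_subset _ _ hy') hc
  exact hne ((comp_eq_of_mem h1).symm.trans (comp_eq_of_mem hy'))

section canon

variable [NeZero L'] [NeZero M]

/-- The large-field sites in the collar of a class are the class itself. [folklore] -/
theorem collar_comp_inter (Ω : Finset (Site L' M)) (x : Site L' M) :
    collar (comp Ω x) ∩ Ω = comp Ω x := by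
  ext z
  simp only [mem_inter, mem_collar]
  constructor
  · rintro ⟨⟨y, hy, hyz⟩, hz⟩
    exact mem_comp_of_close hy hz hyz.close
  · intro hz
    exact ⟨⟨z, hz, near_refl z⟩, comp_subset _ _ hz⟩

omit [NeZero L'] [NeZero M] in
/-- The class of a site of `Ω` is non-empty. [folklore] -/
theorem comp_nonempty {Ω : Finset (Site L' M)} {x : Site L' M} (hx : x ∈ Ω) : (comp Ω x).Nonempty :=
  ⟨x, mem_comp_self hx⟩

/-- Collars of distinct classes are separated: no equal or adjacent pair of sites. [folklore] -/
theorem not_near_of_comp_ne {Ω : Finset (Site L' M)} {x x' s s' : Site L' M}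
    (hne : comp Ω x ≠ comp Ω x') (hs : s ∈ collar (comp Ω x)) (hs' : s' ∈ collar (comp Ω x')) :
    ¬ Near s s' := by
  intro h
  obtain ⟨y, hy, hys⟩ := mem_collar.1 hs
  obtain ⟨y', hy', hys'⟩ := mem_collar.1 hs'
  exact not_close_of_comp_ne hne hy hy' ⟨s, s', hys, h, hys'.symm⟩

/-- The CANONICAL POLYMER FAMILY of a large-field set: the collars of its classes. [folklore] -/
def canon (Ω : Finset (Site L' M)) : Finset (Finset (Site L' M)) :=
  Ω.image fun x => collar (comp Ω x)

/-- Membership in the canonical family, unfolded. [folklore] -/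
theorem mem_canon {Ω : Finset (Site L' M)} {P : Finset (Site L' M)} :
    P ∈ canon Ω ↔ ∃ x ∈ Ω, collar (comp Ω x) = P := mem_image

/-- The canonical family is admissible. [folklore] -/
theorem adm_canon (Ω : Finset (Site L' M)) : Adm Ω (canon Ω) := by
  refine ⟨?_, ?_, ?_⟩
  · intro P hP
    obtain ⟨x, hx, rfl⟩ := mem_canon.1 hP
    exact ⟨x, mem_inter.2 ⟨subset_collar _ (mem_comp_self hx), hx⟩⟩
  · intro P hP Q hQ hPQ s hs s' hs'
    obtain ⟨x, hx, rfl⟩ := mem_canon.1 hP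
    obtain ⟨x', hx', rfl⟩ := mem_canon.1 hQ
    have hne : comp Ω x ≠ comp Ω x' := fun h => hPQ (by rw [h])
    have h := not_near_of_comp_ne hne hs hs'
    exact ⟨fun e => h (Or.inl e), fun a => h (Or.inr a)⟩
  · intro x hx
    exact mem_biUnion.2 ⟨_, mem_image_of_mem _ hx, subset_collar _ (mem_comp_self hx)⟩

omit [NeZero L'] [NeZero M] in
/-- Near sites of a site set are mutually reachable inside the induced graph. [folklore] -/
theorem reachable_induce_of_near {S : Finset (Site L' M)} {u v : Site L' M} (hu : u ∈ S) (hv : v ∈ S)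
    (h : Near u v) :
    ((adjGraph L' M).induce (S : Set (Site L' M))).Reachable ⟨u, hu⟩ ⟨v, hv⟩ := by
  rcases h with rfl | h
  · rfl
  · exact SimpleGraph.Adj.reachable (by exact h)

/-- Each canonical polymer is connected. [folklore] -/
theorem isConn_collar_comp {Ω : Finset (Site L' M)} {x : Site L' M} (hx : x ∈ Ω) :
    IsConn (collar (comp Ω x)) := by
  unfold IsConn
  rw [SimpleGraph.connected_iff_exists_forall_reachable]
  have hxS : x ∈ collar (comp Ω x) := subset_collar _ (mem_comp_self hx)
  refine ⟨⟨x, hxS⟩, ?_⟩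
  have key : ∀ y, Relation.ReflTransGen (lnk Ω) x y → ∃ hy : y ∈ collar (comp Ω x),
      ((adjGraph L' M).induce (collar (comp Ω x) : Set (Site L' M))).Reachable ⟨x, hxS⟩ ⟨y, hy⟩ := by
    intro y h
    induction h with
    | refl => exact ⟨hxS, by rfl⟩
    | @tail b c hxb hbc ih =>
      obtain ⟨hbS, hreach⟩ := ih
      obtain ⟨hbΩ, hcΩ, p, q, hbp, hpq, hqc⟩ := hbc
      have hb : b ∈ comp Ω x := mem_comp.2 ⟨hbΩ, hxb⟩
      have hc : c ∈ comp Ω x := mem_comp_of_close hb hcΩ ⟨p, q, hbp, hpq, hqc⟩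
      have hpS : p ∈ collar (comp Ω x) := mem_collar_of_near hb hbp
      have hqS : q ∈ collar (comp Ω x) := mem_collar_of_near hc hqc.symm
      have hcS : c ∈ collar (comp Ω x) := subset_collar _ hc
      exact ⟨hcS, hreach.trans ((reachable_induce_of_near hbS hpS hbp).trans
        ((reachable_induce_of_near hpS hqS hpq).trans (reachable_induce_of_near hqS hcS hqc)))⟩
  rintro ⟨v, hv⟩
  obtain ⟨y, hy, hyv⟩ := mem_collar.1 hv
  obtain ⟨hyS, hreach⟩ := key y (mem_comp.1 hy).2
  exact hreach.trans (reachable_induce_of_near hyS hv hyv)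

omit [NeZero L'] [NeZero M] in
/-- In a connected polymer, a non-empty subset closed under adjacency (within the polymer) is
everything. [folklore] -/
theorem IsConn.subset_of_adj_closed {P A : Finset (Site L' M)} (hP : IsConn P) (hAP : A ⊆ P)
    {a : Site L' M} (ha : a ∈ A)
    (hcl : ∀ u ∈ A, ∀ v ∈ P, (adjGraph L' M).Adj u v → v ∈ A) : P ⊆ A := by
  intro v hv
  obtain ⟨w⟩ := hP.preconnected ⟨a, hAP ha⟩ ⟨v, hv⟩
  suffices h : ∀ (u v : ↥(P : Set (Site L' M)))
      (w : ((adjGraph L' M).induce (P : Set (Site L' M))).Walk u v), u.1 ∈ A → v.1 ∈ A from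
    h _ _ w ha
  intro u v w
  induction w with
  | nil => exact id
  | @cons u x _ h _ ih => exact fun hu => ih (hcl _ hu _ x.2 h)

/-- **Uniqueness of the admissible family.** An admissible family all of whose polymers are
connected and collar-closed (`P = collar (P ∩ Ω)`) is the canonical family. [folklore] -/
theorem adm_eq_canon {Ω : Finset (Site L' M)} {Ps : Finset (Finset (Site L' M))} (hAdm : Adm Ω Ps)
    (hPs : ∀ P ∈ Ps, IsConn P ∧ P = collar (P ∩ Ω)) : Ps = canon Ω := by
  obtain ⟨hmeet, hsep, hcov⟩ := hAdm
  -- (a) the class of a large-field site of `P` stays inside `P`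
  have hA : ∀ P ∈ Ps, ∀ x ∈ P ∩ Ω, comp Ω x ⊆ P := by
    intro P hP x hx y hy
    have hxP : x ∈ P := (mem_inter.1 hx).1
    suffices h : ∀ y, Relation.ReflTransGen (lnk Ω) x y → y ∈ P from h y (mem_comp.1 hy).2
    intro y h
    induction h with
    | refl => exact hxP
    | @tail b c _ hbc ih =>
      obtain ⟨hbΩ, hcΩ, p, q, hbp, hpq, hqc⟩ := hbc
      obtain ⟨Q, hQ, hcQ⟩ := mem_biUnion.1 (hcov hcΩ)
      by_contra hcP
      have hQP : P ≠ Q := fun e => hcP (e ▸ hcQ)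
      have hpP : p ∈ P := by
        rw [(hPs P hP).2]; exact mem_collar_of_near (mem_inter.2 ⟨ih, hbΩ⟩) hbp
      have hqQ : q ∈ Q := by
        rw [(hPs Q hQ).2]; exact mem_collar_of_near (mem_inter.2 ⟨hcQ, hcΩ⟩) hqc.symm
      have h := hsep P hP Q hQ hQP p hpP q hqQ
      exact hpq.elim h.1 h.2
  -- (b) a polymer containing the large-field site `x` is the collar of the class of `x`
  have hB : ∀ P ∈ Ps, ∀ x ∈ P ∩ Ω, P = collar (comp Ω x) := by
    intro P hP x hx
    have hsub : collar (comp Ω x) ⊆ P := by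
      rw [(hPs P hP).2]
      exact collar_mono fun y hy => mem_inter.2 ⟨hA P hP x hx hy, comp_subset _ _ hy⟩
    refine Subset.antisymm ?_ hsub
    refine (hPs P hP).1.subset_of_adj_closed hsub (subset_collar _ (mem_comp_self (mem_inter.1 hx).2)) ?_
    intro u hu v hv huv
    obtain ⟨y, hy, hyu⟩ := mem_collar.1 hu
    have hv' : v ∈ collar (P ∩ Ω) := by rw [← (hPs P hP).2]; exact hv
    obtain ⟨w, hw, hwv⟩ := mem_collar.1 hv'
    have hwc : w ∈ comp Ω x :=
      mem_comp_of_close hy (mem_inter.1 hw).2 ⟨u, v, hyu, Or.inr huv, hwv.symm⟩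
    exact mem_collar_of_near hwc hwv
  -- (c) compare the two families
  ext P
  constructor
  · intro hP
    obtain ⟨x, hx⟩ := hmeet P hP
    exact mem_canon.2 ⟨x, (mem_inter.1 hx).2, (hB P hP x hx).symm⟩
  · intro hP
    obtain ⟨x, hx, rfl⟩ := mem_canon.1 hP
    obtain ⟨Q, hQ, hxQ⟩ := mem_biUnion.1 (hcov hx)
    rw [← hB Q hQ x (mem_inter.2 ⟨hxQ, hx⟩)]
    exact hQ

end canon

end Literature.Probability.LatticeModels.BalabanStepOne

end
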